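import Mathlib

/-!
# Crux `FeketeSOS.CharPSparseSOS` (stmt-ValiantsHypothesis-14989), line `Sketch` — stub `stub_twoCuspHajos`

Two-cusp Hajós, lower half: a non-zero polynomial `g` of degree `< p` over a field `K` of
characteristic `p` whose coefficient function is deep `≥ D` at the lower cusp (`g_0 = 0` and the top
moments `Σ_{n<p} g_n n^{p-1-d}` vanish for `1 ≤ d < D`) has at least `D` monomials.

Proof (Vandermonde).  Write `S = supp g`, `t = #S`, and suppose `t < D`.  Since `g ≠ 0`, `t ≥ 1`, so
`D ≥ 2`, `g_0 = 0` and `S ⊆ {1, …, p-1}`; in particular `t ≤ p - 1` and `(n : K) ≠ 0` for `n ∈ S`.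
For `e < t` the hypothesis at `d = t - e ∈ [1, D)` reads, after discarding the terms off the support,
`Σ_{n∈S} (g_n n^{p-1-t}) · n^e = 0`.  The nodes `(n : K)`, `n ∈ S`, are pairwise distinct
(`CharP.natCast_injOn_Iio`), so the Vandermonde system has trivial kernel
(`Matrix.eq_zero_of_forall_pow_sum_mul_pow_eq_zero`): `g_n n^{p-1-t} = 0`, hence `g_n = 0`, for every
`n ∈ S` — absurd since `S ≠ ∅`.
-/

-- `Summit.ValiantsHypothesis.ValiantsHypothesis.…` is the tree's mandated single-conjunct layout (Sub = Summit).
set_option linter.dupNamespace false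

namespace Summit.ValiantsHypothesis.ValiantsHypothesis.Theorems.CharPSparseSOSTwoCusp

open Polynomial Finset

/-- **Two-cusp Hajós, lower half.** Over a field `K` of characteristic `p`, a non-zero `g : K[X]` with
`natDegree g < p`, `g.coeff 0 = 0` (when `1 ≤ D`) and vanishing top moments
`Σ_{n<p} g.coeff n * n^{p-1-d} = 0` for `1 ≤ d < D` has at least `D` non-zero coefficients
(Vandermonde on the distinct non-zero nodes `(n : K)`, `n ∈ supp g`). -/
theorem stub_twoCuspHajos :
    ∀ (K : Type) [Field K] (p : ℕ) [Fact p.Prime] [CharP K p] (g : K[X]) (D : ℕ),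
      g ≠ 0 → g.natDegree < p → (1 ≤ D → g.coeff 0 = 0) →
        (∀ d : ℕ, 1 ≤ d → d < D → ∑ n ∈ Finset.range p, g.coeff n * (n : K) ^ (p - 1 - d) = 0) →
          D ≤ g.support.card := by
  intro K _ p _ _ g D hg hdeg h0 hmom
  classical
  by_contra hlt
  rw [not_le] at hlt
  -- `S = supp g` is non-empty, misses `0`, and sits inside `range p`.
  have hSne : g.support.Nonempty := by
    rw [Finset.nonempty_iff_ne_empty, Ne, Polynomial.support_eq_empty]
    exact hg
  have hD1 : 1 ≤ D := le_trans hSne.card_pos hlt.le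
  have hg0 : g.coeff 0 = 0 := h0 hD1
  have hSpos : ∀ n ∈ g.support, n ≠ 0 := by
    intro n hn h
    rw [h] at hn
    exact (mem_support_iff.mp hn) hg0
  have hSlt : ∀ n ∈ g.support, n < p := fun n hn =>
    lt_of_le_of_lt (le_natDegree_of_mem_supp n hn) hdeg
  have hSsub : g.support ⊆ range p := fun n hn => mem_range.mpr (hSlt n hn)
  have htp : g.support.card ≤ p - 1 := by
    have hsub : g.support ⊆ (range p).erase 0 := fun n hn =>
      mem_erase.mpr ⟨hSpos n hn, hSsub hn⟩
    have := card_le_card hsub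
    rwa [card_erase_of_mem (mem_range.mpr (Fact.out : p.Prime).pos), card_range] at this
  have hcast : ∀ n ∈ g.support, (n : K) ≠ 0 := by
    intro n hn h
    rw [CharP.cast_eq_zero_iff K p] at h
    exact absurd (Nat.le_of_dvd (Nat.pos_of_ne_zero (hSpos n hn)) h) (not_le.mpr (hSlt n hn))
  -- The moments, restricted to the support and re-indexed: `Σ_{n∈S} (g_n n^{p-1-t}) n^e = 0`, `e < t`.
  have hmomS : ∀ e : ℕ, e < g.support.card →
      ∑ n ∈ g.support, g.coeff n * (n : K) ^ (p - 1 - g.support.card) * (n : K) ^ e = 0 := by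
    intro e he
    have h1 := hmom (g.support.card - e) (by omega) (by omega)
    rw [← sum_subset hSsub (fun n _ hn => by rw [notMem_support_iff.mp hn, zero_mul])] at h1
    rw [← h1]
    refine sum_congr rfl fun n _ => ?_
    rw [mul_assoc, ← pow_add]
    congr 2
    omega
  -- Index the support by `Fin t` and apply the Vandermonde kernel lemma.
  set t := g.support.card with ht
  let eqv : g.support ≃ Fin t := g.support.equivFin
  let node : Fin t → ℕ := fun j => (eqv.symm j : ℕ)
  have hnode_mem : ∀ j, node j ∈ g.support := fun j => (eqv.symm j).2
  have hnode_inj : Function.Injective node := fun i j h =>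
    eqv.symm.injective (Subtype.ext h)
  let f : Fin t → K := fun j => (node j : K)
  let v : Fin t → K := fun j => g.coeff (node j) * (node j : K) ^ (p - 1 - t)
  have hf : Function.Injective f := fun i j h =>
    hnode_inj (CharP.natCast_injOn_Iio K p (hSlt _ (hnode_mem i)) (hSlt _ (hnode_mem j)) h)
  have hv : v = 0 := by
    refine Matrix.eq_zero_of_forall_pow_sum_mul_pow_eq_zero hf fun i => ?_
    rw [← hmomS i i.isLt, ← sum_coe_sort g.support]
    exact eqv.symm.sum_comp
      (fun s : g.support => g.coeff (s : ℕ) * ((s : ℕ) : K) ^ (p - 1 - t) * ((s : ℕ) : K) ^ (i : ℕ))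
  obtain ⟨n0, hn0⟩ := hSne
  have h2 := congr_fun hv (eqv ⟨n0, hn0⟩)
  simp only [v, node, Equiv.symm_apply_apply, Pi.zero_apply] at h2
  rcases mul_eq_zero.mp h2 with h | h
  · exact (mem_support_iff.mp hn0) h
  · exact hcast n0 hn0 (pow_eq_zero_iff'.mp h).1

end Summit.ValiantsHypothesis.ValiantsHypothesis.Theorems.CharPSparseSOSTwoCusp
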